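import Summits.QuantumAdvantage.QuantumAdvantage.Theorems.PebbleDial
import Summits.QuantumAdvantage.QuantumAdvantage.Theorems.FlatDialMMDual
import Literature.ModelTheory.FiniteModelTheory.AtseriasDawar3Xor
import Literature.Computability.QuantumComplexity.ForrelationSignTransport
import Literature.Probability.LatticeModels.MedialPerturbation

/-! # GaugeDial — tree twin of the lens-3 g15 node (laws only; the `closes` junction stays in the Theses node)

Certified content of `run/shared/lean/pub/decomp-qadv/decomp-qadv-lens-3/g15/GaugeDial.lean` (§1–§4c verbatim, namespace moved from
`…Theses.GaugeDial` to `…Theorems.GaugeDial`, §5 `closes`/`closes_gauge` omitted): signed gauge systems and the EQUIV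
`gaugeFooling_iff_foolingPairs : GaugeFooling k ↔ PebbleDial.FoolingPairs k`; the parity law `SignedGaugeSystem.even_card_star`; rail forms
(`railForm` = Atserias–Dawar doubling of a 3-XOR instance read in ANF) with the ★ gauge law `permForm_railSwap_railForm` and `homog_flipAt`;
the split `foolingPairs_of_rails : RailInvisible k → RailCarrier k → FoolingPairs k` (and `symRung_of_rails`); the ★ carrier law
(`BlowupKey.key_key`, `BlowupKey.forrelation_eq_one`); the ★ root law (`mmDualFn_origin_eq_of_root`); the ★ twist-partner law
(`mmDualFn_twist`, `twist_partner_sign`); the ★ diagonal law / sign rigidity (`walsh_diag_eq_W`, `sign_rigidity`, `dominant_sign_eq_of_diag`);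
`gaugeDial_summary`.  Record: NODE-g15.md next to the node.  0 sorry; axioms ⊆ {propext, Classical.choice, Quot.sound}. -/

set_option linter.dupNamespace false

noncomputable section

namespace Summit.QuantumAdvantage.QuantumAdvantage.Theorems.GaugeDial

open Finset
open Literature.Computability.Complexity
open Literature.Computability.QuantumComplexity
open Literature.ModelTheory.FiniteModelTheory
open Summit.QuantumAdvantage.QuantumAdvantage.Theses.AnfPresentation
  (AnfResidual RungA LiftA NearExactIsExact SignedExactSliceIsLift AnfEquiv)
open Summit.QuantumAdvantage.QuantumAdvantage.Theorems.PebbleDial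

/-! ## §1 The language: SIGNED GAUGE SYSTEMS (Cai–Fürer–Immerman twists read on exact cubic pairs) -/

/-- [dictionary · the new language] A SIGNED GAUGE SYSTEM of arity `n` with `q` gadgets and `m` rails: a family of
ANF instances `(F U, G U)` indexed by TWIST SETS `U ⊆ [q]`, rail involutions `σ e ∈ S_n` with stars `st e ⊆ [q]`,
subject to the GAUGE LAW (relabelling the variables by `σ e` moves the twist set by the star of `e` — the CFI
identity "swapping the two wires of a rail re-twists the adjacent gadgets") and the SIGN = CHARGE LAW (the instance
with twist set `U` is exact, of sign `(-1)^{|U|}`). -/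
structure SignedGaugeSystem (n q m : ℕ) where
  /-- first table of the instance with twist set `U` -/
  F : Finset (Fin q) → CubicForm n
  /-- second table (the partner) -/
  G : Finset (Fin q) → CubicForm n
  /-- the rail swaps -/
  σ : Fin m → Equiv.Perm (Fin n)
  /-- the star of a rail: the gadgets it re-twists -/
  st : Fin m → Finset (Fin q)
  gaugeF : ∀ e U, permForm (σ e) (F U) = F (symmDiff U (st e))
  gaugeG : ∀ e U, permForm (σ e) (G U) = G (symmDiff U (st e))
  signed : ∀ U, (⟨n, F U, G U⟩ : CubicANFPair).value = if Even U.card then 1 else -1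

namespace SignedGaugeSystem

variable {n q m : ℕ}

/-- [dictionary] the CHARGE of a twist set: its parity. -/
def charge (U : Finset (Fin q)) : Bool := decide (Even U.card)

/-- A UNIT TWIST `v` is `k`-INVISIBLE: Duplicator wins the bijective `k`-pebble game between the untwisted instance
and the instance twisted at the single gadget `v`. -/
def Invisible (k : ℕ) (S : SignedGaugeSystem n q m) : Prop :=
  ∃ v : Fin q, CkEquivANF k (S.F ∅) (S.G ∅) (S.F {v}) (S.G {v})

/-- the untwisted instance is exact `+1`. -/
theorem value_empty (S : SignedGaugeSystem n q m) : (⟨n, S.F ∅, S.G ∅⟩ : CubicANFPair).value = 1 := by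
  rw [S.signed ∅]; simp

/-- a unit twist is exact `-1`. -/
theorem value_single (S : SignedGaugeSystem n q m) (v : Fin q) :
    (⟨n, S.F {v}, S.G {v}⟩ : CubicANFPair).value = -1 := by
  rw [S.signed {v}]; simp

/-- ★ [law, PROVED] SIGNED GAUGE SYSTEMS HAVE EVEN STARS.  Twisting along a whole star is a relabelling of the
variables (gauge law), relabellings preserve the forrelation value (tree: `PebbleDial.value_permPair`), and the
sign is the charge: so every star has even cardinality — the charge group is a genuine parity (Tseitin/CFI)
quotient, never a single re-twistable gadget. -/
theorem even_card_star (S : SignedGaugeSystem n q m) (e : Fin m) : Even (S.st e).card := by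
  have hF : permForm (S.σ e) (S.F ∅) = S.F (S.st e) := by
    rw [S.gaugeF e ∅]; exact congrArg S.F (bot_symmDiff (S.st e))
  have hG : permForm (S.σ e) (S.G ∅) = S.G (S.st e) := by
    rw [S.gaugeG e ∅]; exact congrArg S.G (bot_symmDiff (S.st e))
  have hv : (⟨n, S.F (S.st e), S.G (S.st e)⟩ : CubicANFPair).value = 1 := by
    have := value_permPair ⟨n, S.F ∅, S.G ∅⟩ (S.σ e)
    rw [S.value_empty] at this
    rw [← this]
    show (⟨n, S.F (S.st e), S.G (S.st e)⟩ : CubicANFPair).value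
        = (⟨n, permForm (S.σ e) (S.F ∅), permForm (S.σ e) (S.G ∅)⟩ : CubicANFPair).value
    rw [hF, hG]
  by_contra hodd
  rw [S.signed (S.st e), if_neg hodd] at hv
  norm_num at hv

/-- no star is a single gadget: a lone re-twistable gadget would be an odd star. -/
theorem st_ne_singleton (S : SignedGaugeSystem n q m) (e : Fin m) (v : Fin q) : S.st e ≠ {v} := by
  intro h
  have := S.even_card_star e
  rw [h, card_singleton] at this
  exact Nat.not_even_one this

end SignedGaugeSystem

/-- [the language, as a statement] `GaugeFooling k`: for infinitely many even arities there is a signed gauge system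
with a `k`-invisible unit twist. -/
def GaugeFooling (k : ℕ) : Prop :=
  ∀ n₀ : ℕ, ∃ n, n₀ ≤ n ∧ Even n ∧ ∃ q m : ℕ, ∃ S : SignedGaugeSystem n q m, S.Invisible k

/-- the degenerate one-gadget, no-rail system carried by any pair of exact instances of opposite sign. -/
def pairSystem {n : ℕ} (F G F' G' : CubicForm n)
    (h₁ : (⟨n, F, G⟩ : CubicANFPair).value = 1) (h₂ : (⟨n, F', G'⟩ : CubicANFPair).value = -1) :
    SignedGaugeSystem n 1 0 where
  F U := if (0 : Fin 1) ∈ U then F' else F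
  G U := if (0 : Fin 1) ∈ U then G' else G
  σ e := e.elim0
  st e := e.elim0
  gaugeF e := e.elim0
  gaugeG e := e.elim0
  signed U := by
    by_cases h0 : (0 : Fin 1) ∈ U
    · have hU : U = {0} := Finset.eq_singleton_iff_unique_mem.2 ⟨h0, fun x _ => Subsingleton.elim x 0⟩
      subst hU
      simp only [mem_singleton, if_true, card_singleton]
      rw [h₂]; simp
    · have hU : U = ∅ := Finset.eq_empty_of_forall_notMem fun x hx => h0 (by rwa [Subsingleton.elim x 0] at hx)
      subst hU
      simp only [Finset.notMem_empty, if_false, card_empty]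
      rw [h₁]; simp

/-- ★★ [THE ONE CERTIFIED EQUIV of this node] `GaugeFooling k ↔ FoolingPairs k`.  (`→`: the untwisted and a
unit-twisted instance of a signed gauge system are an exact `+1` / exact `-1` pair, `k`-indistinguishable by
invisibility.  `←`: any fooling pair is the degenerate one-gadget system `pairSystem`.)  The content of the
translation is not this equivalence but the calculus it opens (§1 even-star law, §2 rail forms = doubled 3-XOR
systems, §4 carriers): fooling pairs can now be sought as TWISTS of ONE uniformly built family. -/
theorem gaugeFooling_iff_foolingPairs (k : ℕ) : GaugeFooling k ↔ FoolingPairs k := by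
  constructor
  · intro h n₀
    obtain ⟨n, hn, he, q, m, S, v, hv⟩ := h n₀
    exact ⟨n, hn, he, S.F ∅, S.G ∅, S.F {v}, S.G {v}, hv, S.value_empty, S.value_single v⟩
  · intro h n₀
    obtain ⟨n, hn, he, F, G, F', G', hequiv, h₁, h₂⟩ := h n₀
    refine ⟨n, hn, he, 1, 0, pairSystem F G F' G' h₁ h₂, 0, ?_⟩
    show CkEquivANF k (if (0 : Fin 1) ∈ (∅ : Finset (Fin 1)) then F' else F)
      (if (0 : Fin 1) ∈ (∅ : Finset (Fin 1)) then G' else G)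
      (if (0 : Fin 1) ∈ ({0} : Finset (Fin 1)) then F' else F)
      (if (0 : Fin 1) ∈ ({0} : Finset (Fin 1)) then G' else G)
    simpa using hequiv


/-! ## §2 RAIL FORMS: the cubic table of a 3-XOR instance on DOUBLED variables (CFI gadget = cubic monomial block)

The dictionary to the tree's finite model theory (`FiniteModelTheory.Xor3`, Atserias–Dawar 2019 §3.2): a rail `x`
carries two wires `x⁰, x¹` (the DOUBLING `G(I)` of a 3-XOR instance `I`); the cube table of the RAIL FORM of `I`
over a swap-invariant base table is `base ⊕ R₀^{G(I)}`: its entry at the wires `(x^a, y^b, z^c)` is flipped iff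
`x + y + z = a + b + c` is an equation of `I`.  As a polynomial, an equation `e₁ + e₂ + e₃ = u` contributes the
CFI GADGET `a₁s₂s₃ ⊕ a₂s₁s₃ ⊕ a₃s₁s₂ ⊕ (1 ⊕ u)·s₁s₂s₃` (`a_e = x_e⁰`, `s_e = x_e⁰ ⊕ x_e¹`): swapping the two wires of
rail `e₁` adds the TWIST MONOMIAL `s₁s₂s₃`, i.e. flips the right-hand side `u` — the gauge law below. -/

section Rails

variable {m : ℕ}

/-- [dictionary] the wire `x^c` (`c`-th copy of rail `x`), packed into `Fin (m * 2)`. -/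
def wire (x : Fin m) (c : Fin 2) : Fin (m * 2) := finProdFinEquiv (x, c)

/-- [dictionary] the rail of a wire. -/
def rail (i : Fin (m * 2)) : Fin m := (finProdFinEquiv.symm i).1

/-- [dictionary] the copy index of a wire, read in `𝔽₂`. -/
def copy (i : Fin (m * 2)) : ZMod 2 := if (finProdFinEquiv.symm i).2 = 0 then 0 else 1

/-- GaugeDialLawsA helper `rail_wire` (decomp-qadv land package; see the module docstring). -/
theorem rail_wire (x : Fin m) (c : Fin 2) : rail (wire x c) = x := by
  simp [rail, wire]

/-- GaugeDialLawsA helper `copy_wire_zero` (decomp-qadv land package; see the module docstring). -/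
theorem copy_wire_zero (x : Fin m) : copy (wire x 0) = 0 := by
  simp [copy, wire]

/-- GaugeDialLawsA helper `copy_wire_one` (decomp-qadv land package; see the module docstring). -/
theorem copy_wire_one (x : Fin m) : copy (wire x 1) = 1 := by
  simp [copy, wire]

/-- GaugeDialLawsA helper `eq_wire_rail` (decomp-qadv land package; see the module docstring). -/
theorem eq_wire_rail (i : Fin (m * 2)) : i = wire (rail i) 0 ∨ i = wire (rail i) 1 := by
  have hi : wire (rail i) (finProdFinEquiv.symm i).2 = i := by
    show finProdFinEquiv ((finProdFinEquiv.symm i).1, (finProdFinEquiv.symm i).2) = i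
    rw [Prod.mk.eta, Equiv.apply_symm_apply]
  rcases Literature.Probability.LatticeModels.fin_two_eq_zero_or_one (finProdFinEquiv.symm i).2 with hc | hc
  · left; rw [← hc]; exact hi.symm
  · right; rw [← hc]; exact hi.symm

/-- [dictionary · THE TABLE] the RAIL FORM of a 3-XOR instance `I` on `m` rails over the base table `base`:
`cube (x^a) (y^b) (z^c) = base ⊕ [x + y + z = a + b + c ∈ I]` (= `base ⊕ R₀` of the doubled instance `G(I)`). -/
def railForm (base : CubicForm (m * 2)) (I : Xor3.Instance (Fin m)) : CubicForm (m * 2) :=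
  ⟨base.const, fun i j l => xor (base.cube i j l) (decide ((rail i, rail j, rail l, copy i + copy j + copy l) ∈ I))⟩

/-- [dictionary] the RAIL SWAP `x⁰ ↔ x¹` — a relabelling of the variables. -/
def railSwap (x₀ : Fin m) : Equiv.Perm (Fin (m * 2)) := Equiv.swap (wire x₀ 0) (wire x₀ 1)

/-- the indicator of the rail `x₀`, in `𝔽₂`. -/
def ind (x₀ y : Fin m) : ZMod 2 := if y = x₀ then 1 else 0

/-- [dictionary] RE-TWISTING at rail `x₀`: flip the right-hand side of an equation once per occurrence of `x₀`. -/
def flipEq (x₀ : Fin m) (e : Xor3.Equation (Fin m)) : Xor3.Equation (Fin m) :=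
  (e.1, e.2.1, e.2.2.1, e.2.2.2 + (ind x₀ e.1 + ind x₀ e.2.1 + ind x₀ e.2.2.1))

/-- [dictionary] the re-twisted instance `I^{x₀}` (the star of `x₀` flipped). -/
def flipAt (x₀ : Fin m) (I : Xor3.Instance (Fin m)) : Xor3.Instance (Fin m) := I.map (flipEq x₀)

/-- GaugeDialLawsA helper `flipEq_flipEq` (decomp-qadv land package; see the module docstring). -/
theorem flipEq_flipEq (x₀ : Fin m) (e : Xor3.Equation (Fin m)) : flipEq x₀ (flipEq x₀ e) = e := by
  obtain ⟨x, y, z, b⟩ := e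
  have h : ∀ a d : ZMod 2, a + d + d = a := by decide
  simp only [flipEq, h]

/-- GaugeDialLawsA helper `mem_flipAt` (decomp-qadv land package; see the module docstring). -/
theorem mem_flipAt {x₀ : Fin m} {I : Xor3.Instance (Fin m)} {e : Xor3.Equation (Fin m)} :
    e ∈ flipAt x₀ I ↔ flipEq x₀ e ∈ I := by
  constructor
  · rintro h
    obtain ⟨e', he', rfl⟩ := Multiset.mem_map.1 h
    rwa [flipEq_flipEq]
  · intro h
    exact Multiset.mem_map.2 ⟨_, h, flipEq_flipEq x₀ e⟩

/-- GaugeDialLawsA helper `flipAt_flipAt` (decomp-qadv land package; see the module docstring). -/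
theorem flipAt_flipAt (x₀ : Fin m) (I : Xor3.Instance (Fin m)) : flipAt x₀ (flipAt x₀ I) = I := by
  simp only [flipAt, Multiset.map_map, Function.comp_def, flipEq_flipEq, Multiset.map_id']

/-- the rail swap keeps rails … -/
theorem rail_railSwap (x₀ : Fin m) (i : Fin (m * 2)) : rail (railSwap x₀ i) = rail i := by
  unfold railSwap
  rcases eq_or_ne i (wire x₀ 0) with h0 | h0
  · subst h0; rw [Equiv.swap_apply_left, rail_wire, rail_wire]
  rcases eq_or_ne i (wire x₀ 1) with h1 | h1
  · subst h1; rw [Equiv.swap_apply_right, rail_wire, rail_wire]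
  rw [Equiv.swap_apply_of_ne_of_ne h0 h1]

/-- … and shifts the copy index by the indicator of `x₀`. -/
theorem copy_railSwap (x₀ : Fin m) (i : Fin (m * 2)) : copy (railSwap x₀ i) = copy i + ind x₀ (rail i) := by
  have h2 : ∀ a : ZMod 2, a = a + 1 + 1 := by decide
  unfold railSwap
  rcases eq_or_ne i (wire x₀ 0) with h0 | h0
  · subst h0; rw [Equiv.swap_apply_left, copy_wire_one, copy_wire_zero, rail_wire]; simp [ind]
  rcases eq_or_ne i (wire x₀ 1) with h1 | h1
  · subst h1; rw [Equiv.swap_apply_right, copy_wire_one, copy_wire_zero, rail_wire]; simp [ind]; exact h2 0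
  rw [Equiv.swap_apply_of_ne_of_ne h0 h1]
  have hne : rail i ≠ x₀ := by
    intro h
    rcases eq_wire_rail i with hc | hc
    · exact h0 (by rw [hc, h])
    · exact h1 (by rw [hc, h])
  simp [ind, hne]

/-- ★ [dictionary law, PROVED] THE GAUGE LAW OF RAIL FORMS: swapping the two wires of rail `x₀` is the SAME TABLE as
re-twisting the instance at `x₀` — for every base table fixed by that swap.  (Cai–Fürer–Immerman's gadget identity,
here an identity of cubic ANF tables.) -/
theorem permForm_railSwap_railForm (x₀ : Fin m) {base : CubicForm (m * 2)}
    (hbase : permForm (railSwap x₀) base = base) (I : Xor3.Instance (Fin m)) :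
    permForm (railSwap x₀) (railForm base I) = railForm base (flipAt x₀ I) := by
  have hb : ∀ i j l, base.cube (railSwap x₀ i) (railSwap x₀ j) (railSwap x₀ l) = base.cube i j l :=
    fun i j l => congrArg (fun F : CubicForm (m * 2) => F.cube i j l) hbase
  simp only [permForm, railForm, CubicForm.mk.injEq, true_and]
  funext i j l
  rw [hb, rail_railSwap, rail_railSwap, rail_railSwap, copy_railSwap, copy_railSwap, copy_railSwap]
  congr 1
  have key : ((rail i, rail j, rail l,
      copy i + ind x₀ (rail i) + (copy j + ind x₀ (rail j)) + (copy l + ind x₀ (rail l))) : Xor3.Equation (Fin m))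
      = flipEq x₀ (rail i, rail j, rail l, copy i + copy j + copy l) := by
    simp only [flipEq, Prod.mk.injEq, true_and]; ring
  rw [decide_eq_decide, key, mem_flipAt]


end Rails
end Summit.QuantumAdvantage.QuantumAdvantage.Theorems.GaugeDial
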